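import Mathlib
import Summits.Ventures.HodgeRepro.Tier4.Common.KTypeSpace
import Summits.Ventures.HodgeRepro.Tier4.Common.SettingOfData
import Summits.Ventures.HodgeRepro.Tier4.Line1.SpectralOfRTF
import Summits.Ventures.HodgeRepro.Tier4.Line4.W4SpectralBridge
import Summits.Ventures.HodgeRepro.Tier4.Line4.W3Reduction2
import Summits.Ventures.HodgeRepro.Tier4.Line4.W3TwoVector

/-!
# Tier4/Line4/W3TwoVectorHit — the two-vector wall W3⁗, HIT-INDEXED and WITHOUT `hadm` (cut C-L4-2VEC-HIT, t4-plan-4 g3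
S14313): the constituent exhibited, the predicate form for any predicate on the constituents

Blind re-derivation cell `pub-hodge-repro`, Tier 4 «prove the step» (README §9–§10), seat t4-L4-p1 (prover, LINE L4,
gen 3).  Tree path `lean/Summits/Ventures/HodgeRepro/Tier4/Line4/W3TwoVectorHit.lean`.  Statements = t4-plan-4 g3's
STATEMENTS file (HOME proofs/t4-plan-4/work/W3TwoVectorHit-STATEMENTS.lean, 9957d3413bd4fdaf) verbatim; the proof of (1) is
t4-L1-p5's `mixed_two_torus_W3_twoVector` (W3TwoVector.lean) up to its final step, which no longer needs the admissibility
hypothesis `hadm`: the hit constituent `τ (n j)` is EXHIBITED together with the two vectors `conj (R(f₂ˇ) φ_j)` (non-zero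
`T′`-period) and `conj (R(f̄₁) φ_j)` (non-zero `T`-period) of `kTypeSpace' … K (V (n j))`.

WHAT IS PROVED.
* `mixed_two_torus_W3_twoVector_hit`: from an adapted ONB `(τ, φ, n)` of `Setting.ofAdelicData`, a compact open level `K`,
  the stability clauses `hst₁ hst₂` and `Jc(f₁ ⋆ f₂) ≠ 0`: some `j` with `Hit (cj f₁) (τ (n j))` and the two non-zero periods.
* `mixed_two_torus_W3_twoVector_pred`: the predicate form — for ANY `P` on the constituents holding on every hit one,
  some `V₀` with `P V₀` and a level `K₀` carrying the two vectors (the old theorem is `P := IsAdmissibleS …`).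

A consumer reads the `K`-type conjuncts of admissibility off the two periods (`KTypeOfPeriod`, `KTypeOfPeriodPrimed`,
`KTypeOfPeriodClosed`) and asks `P` only for the rest.  Nothing here says anything about the status of the Hodge
conjecture for CM abelian varieties, which is NOT proved (HC_CM is NOT proved by anyone in this repository).
-/

set_option autoImplicit false

noncomputable section

namespace Summit.Ventures.HodgeRepro.Tier4.Line4

open Summit.Ventures.HodgeRepro.Tier4.Common Summit.Ventures.HodgeRepro.Tier4.Line1 MeasureTheory NumberField
open scoped ComplexConjugate

section Hit

variable {k : Type} [Field k] [NumberField k] (W : PlaneData k) [MeasurableSpace (GA W)] [BorelSpace (GA W)]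
  (R : RTFData W) (μ : Measure (GA W)) [μ.IsHaarMeasure] [R.μT.IsHaarMeasure] [R.μT'.IsHaarMeasure]
  (DG : Set (GA W)) (fdG : IsFundamentalDomain (rationalPoints W) DG μ) (compG : IsCompact (closure DG))
  (compT : IsCompact (closure R.DT)) (compT' : IsCompact (closure R.DT'))

/-- **THE TWO-VECTOR WALL, HIT-INDEXED** (cut C-L4-2VEC-HIT): `mixed_two_torus_W3_twoVector` WITHOUT `hadm` and with the
constituent EXHIBITED — some `m` hit by `f̄₁` whose `kTypeSpace' … K (V m)` carries the two explicit vectors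
`conj (R(f₂ˇ) φ_j)` (non-zero `T′`-period) and `conj (R(f̄₁) φ_j)` (non-zero `T`-period) for `m = n j`. Every consumer
recovers the predicate form by instantiation (admissibility, or only its non-`K`-type conjuncts with the `K`-types read
off the two periods through `KTypeOfPeriod` / `KTypeOfPeriodPrimed`).  Binders as in the planner's statement, in the same
order; the level and stability clauses `K`, `_hK`, `_hst₁`, `_hst₂` are idle in THIS form (they are used by `_pred`) and carry
the underscore only for the unused-variable lint. -/
theorem mixed_two_torus_W3_twoVector_hit (hc : Continuous R.chi) (hu : ∀ a, ‖R.chi a‖ = 1)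
    (hc' : Continuous R.chi') (hunit' : ∀ t, ‖R.chi' t‖ = 1)
    (q : QuadData k) (g g' : Matrix (Fin 4) (Fin 4) k)
    (eP' eM' : InfinitePlace k → ℤ) (V : ℕ → Submodule ℂ (GA W → ℂ))
    (K : Subgroup (GA W)) (_hK : IsCompactOpenIn W (finitePart W) K)
    {τ : ℕ → Set (GA W → ℂ)} {φ : ℕ → GA W → ℂ} {n : ℕ → ℕ}
    (hB : (Setting.ofAdelicData W R μ DG fdG compG compT compT').IsAdaptedONB τ φ n)
    {f₁ f₂ : GA W → ℂ} (h₁ : IsTestFn W f₁) (h₂ : IsTestFn W f₂)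
    (_hst₁ : ∀ j, (fun x => conj (rightRegular W μ (RTF.cj f₁) (φ j) x)) ∈
      kTypeSpace' W q g g' eP' eM' K (V (n j)))
    (_hst₂ : ∀ j, (fun x => conj (rightRegular W μ (RTF.refl f₂) (φ j) x)) ∈
      kTypeSpace' W q g g' eP' eM' K (V (n j)))
    (hJ : R.Jc ((Setting.ofAdelicData W R μ DG fdG compG compT compT').conv f₁ f₂) ≠ 0) :
    ∃ j : ℕ, (Setting.ofAdelicData W R μ DG fdG compG compT compT').Hit (RTF.cj f₁) (τ (n j)) ∧
      periodLin W R.μT' R.DT' R.chi'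
        (restrictTo W (torusT' W) fun x => conj (rightRegular W μ (RTF.refl f₂) (φ j) x)) ≠ 0 ∧
      periodLin W R.μT R.DT R.chi
        (restrictTo W (torusT W) fun x => conj (rightRegular W μ (RTF.cj f₁) (φ j) x)) ≠ 0 := by
  set S := Setting.ofAdelicData W R μ DG fdG compG compT compT' with hS
  haveI := t2Space_GA W
  have h₁' : RTF.IsTest f₁ := ⟨h₁.1, h₁.2⟩
  have h₂' : RTF.IsTest f₂ := ⟨h₂.1, h₂.2⟩
  have hconv : IsTestFn W (S.conv f₁ f₂) :=
    ⟨(S.conv_isTest h₁' h₂').1.cont, (S.conv_isTest h₁' h₂').1.compact⟩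
  have hJ' : S.J R.chi R.chi' (S.conv f₁ f₂) ≠ 0 := by
    rw [← Jc_eq_J W R μ DG fdG compG compT compT' hc hc' hconv]
    exact hJ
  -- a non-zero block, then a non-zero term
  obtain ⟨m, hm⟩ := S.exists_specBlock_ne_zero R.chi R.chi' φ n f₁ f₂
    (isCharacter_chi W R μ DG fdG compG compT compT' hc hu)
    (isCharacter'_chi' W R μ DG fdG compG compT compT' hc' hunit') hB h₁' h₂' hJ'
  obtain ⟨j, hnj, hterm⟩ := S.exists_specTerm_ne_zero_of_specBlock_ne_zero R.chi R.chi' φ n f₁ f₂ hm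
  -- the two factors
  have hterm' := hterm
  unfold RTF.Setting.specTerm at hterm'
  have hP' : S.periodT' R.chi' (fun t' => S.R (RTF.refl f₂) (φ j) t') ≠ 0 := left_ne_zero_of_mul hterm'
  have hP : conj (S.periodT R.chi (fun t => S.R (RTF.cj f₁) (φ j) t)) ≠ 0 := right_ne_zero_of_mul hterm'
  -- the hit constituent
  have hhit : S.Hit (RTF.cj f₁) (τ (n j)) := (S.atoms hB h₁' h₂' j hterm).2.2
  -- continuity of the two vectors
  have hc₁ : Continuous (S.R (RTF.cj f₁) (φ j)) :=
    (hB.inv (n j)).cont _ ((hB.inv (n j)).conv (φ j) (hB.mem j) _ h₁'.cj)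
  have hc₂ : Continuous (S.R (RTF.refl f₂) (φ j)) :=
    (hB.inv (n j)).cont _ ((hB.inv (n j)).conv (φ j) (hB.mem j) _ h₂'.refl)
  refine ⟨j, hhit, ?_, ?_⟩
  · rw [← R_ofAdelicData_eq W R μ DG fdG compG compT compT',
      periodLin_chi'_conj_eq W R μ DG fdG compG compT compT' hc' hc₂]
    intro h0
    apply hP'
    have := congrArg conj h0
    rw [Complex.conj_conj, map_zero] at this
    exact this
  · rw [← R_ofAdelicData_eq W R μ DG fdG compG compT compT',
      periodLin_chi_conj_eq W R μ DG fdG compG compT compT' hc hc₁]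
    exact hP

/-- The predicate form: `mixed_two_torus_W3_twoVector` with `IsAdmissibleS` replaced by ANY predicate `P` on the
constituents (so a consumer may ask only for what it cannot read off the periods). -/
theorem mixed_two_torus_W3_twoVector_pred (hc : Continuous R.chi) (hu : ∀ a, ‖R.chi a‖ = 1)
    (hc' : Continuous R.chi') (hunit' : ∀ t, ‖R.chi' t‖ = 1)
    (q : QuadData k) (g g' : Matrix (Fin 4) (Fin 4) k)
    (eP' eM' : InfinitePlace k → ℤ) (V : ℕ → Submodule ℂ (GA W → ℂ))
    (K : Subgroup (GA W)) (hK : IsCompactOpenIn W (finitePart W) K)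
    {τ : ℕ → Set (GA W → ℂ)} {φ : ℕ → GA W → ℂ} {n : ℕ → ℕ}
    (hB : (Setting.ofAdelicData W R μ DG fdG compG compT compT').IsAdaptedONB τ φ n)
    {f₁ f₂ : GA W → ℂ} (h₁ : IsTestFn W f₁) (h₂ : IsTestFn W f₂)
    (hst₁ : ∀ j, (fun x => conj (rightRegular W μ (RTF.cj f₁) (φ j) x)) ∈
      kTypeSpace' W q g g' eP' eM' K (V (n j)))
    (hst₂ : ∀ j, (fun x => conj (rightRegular W μ (RTF.refl f₂) (φ j) x)) ∈
      kTypeSpace' W q g g' eP' eM' K (V (n j)))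
    (P : Submodule ℂ (GA W → ℂ) → Prop)
    (hP : ∀ m, (Setting.ofAdelicData W R μ DG fdG compG compT compT').Hit (RTF.cj f₁) (τ m) → P (V m))
    (hJ : R.Jc ((Setting.ofAdelicData W R μ DG fdG compG compT compT').conv f₁ f₂) ≠ 0) :
    ∃ V₀ : Submodule ℂ (GA W → ℂ), P V₀ ∧
      ∃ K₀ : Subgroup (GA W), IsCompactOpenIn W (finitePart W) K₀ ∧
        (∃ f ∈ kTypeSpace' W q g g' eP' eM' K₀ V₀,
          periodLin W R.μT' R.DT' R.chi' (restrictTo W (torusT' W) f) ≠ 0) ∧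
        ∃ f ∈ kTypeSpace' W q g g' eP' eM' K₀ V₀,
          periodLin W R.μT R.DT R.chi (restrictTo W (torusT W) f) ≠ 0 := by
  obtain ⟨j, hhit, hper', hper⟩ := mixed_two_torus_W3_twoVector_hit W R μ DG fdG compG compT compT' hc hu hc' hunit'
    q g g' eP' eM' V K hK hB h₁ h₂ hst₁ hst₂ hJ
  exact ⟨V (n j), hP (n j) hhit, K, hK, ⟨_, hst₂ j, hper'⟩, ⟨_, hst₁ j, hper⟩⟩

end Hit

end Summit.Ventures.HodgeRepro.Tier4.Line4

end
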